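import Summits.ValiantsHypothesis.ValiantsHypothesis.Theorems.DivisionGapPerDivisionHardStubColContentRigid
import Summits.ValiantsHypothesis.ValiantsHypothesis.Theorems.DivisionGapPerDivisionHardStubSplitFlow
import Summits.ValiantsHypothesis.ValiantsHypothesis.Theorems.DivisionGapPerDivisionHardStubGreedyRows

/-!
# Crux `DivisionGap.PerDivisionHard` (stmt-ValiantsHypothesis-5065), line `pair-descent-jss-endpoint` —
stub `stub_cellContentRigid`: K2 for cofactors of small RANK across an arbitrary balanced CELL partition
(column mode)

For a cell set `Y ⊆ Fin n × Fin n` and an exponent vector `m` let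
`colContent_Y(m) := (Σ_{r : (r,c) ∈ Y} m(r,c))_c` and `V_Y(h) := {colContent_Y(m) : m ∈ supp h}`.  A column `c`
is LIVE if more than `n/64` cells `(r,c)` lie in `Y` and more than `n/64` lie outside `Y`.

`stub_cellContentRigid`: for all `c d` and all large `n`, every nonzero torus-homogeneous `h ∈ ℝ≥0[x_ij]`
with `|V_Y(h)| ≤ 2^{(log₂ n + c)^c}` for a cell set `Y` with at least `n/8` live columns admits a placement
`eR eC` of the block arsenal `G(b,k) ⊕ M₀` with `b ≥ (log₂ n + d)^d`, a weight `w` cutting out the placed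
face of the Birkhoff polytope, and a single `G`-part `u` of its top-`w` fibre.

Proof (parameters `L = log₂ n`, `q = (L + c + d + 1)^{c+d+5}`, `b = q`, `k = q + 1`,
`N = q + q²(q+1) ≤ 4q³ ≤ n/64` core labels, `t₀ = q`, via `growth (c+d+4)` at `L - 4`).
1. CORE COLUMNS BY COUNTING INSIDE THE LIVE COLUMNS (`exists_goodSubset` on the subtype of live
   columns, `count_lt`): for an ordered pair `(v₁, v₂)` of values of `V_Y(h)` let `T(v₁,v₂)` be the set of
   columns where they differ; the pairs with `≥ q` live such columns are at most `|V_Y(h)|² ≤ 2^q`, so some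
   `N`-set `S` of live columns contains the live part of no such `T`.
2. GREEDY ROWS (`stub_greedyRows`): label the columns with core/internal labels inside `S` and the rows so
   that `Y` SPLITS the two cells of every internal column (possible: a live column has more than `N` rows of
   each colour).
3. The generic weight cuts out the placed face `G` and its top fibre agrees off `G`
   (`cutsOut_genericWeight`, `eq_offG_of_mem_support_topComponent`).
4. Two fibre monomials `m₁ ≠ m₂` differ by a circulation `D` of the placed graph; SPLITS DETECT IT
   (`stub_splitFlow`): the `Y`-column-sums of `D` — the differences of `colContent_Y(m₁)`, `colContent_Y(m₂)` —
   are nonzero on `≥ k - 1 = q` columns, all of them core columns, i.e. `T ⊆ S` (live, `|T| ≥ q`): excluded.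
   So the top fibre is a single monomial `m₀`, and `u = m₀|_G`.
-/

noncomputable section

-- `Summit.ValiantsHypothesis.ValiantsHypothesis.…` is the tree's mandated single-conjunct layout
-- (Sub = Summit), so the duplicated namespace component is intended.
set_option linter.dupNamespace false

namespace Summit.ValiantsHypothesis.ValiantsHypothesis.Theorems.DivisionGapPerDivisionHard

open MvPolynomial Literature.Computability.AlgebraicComplexity
open Summit.ValiantsHypothesis.ValiantsHypothesis.Theorems.ZeroOneTransfer.Negative
open scoped NNReal


variable {n : ℕ}

/-- The growth bookkeeping of `stub_cellContentRigid`: for all large `L`, with `q = (L + E + 1)^{E+5}`,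
`256 q³ ≤ 2^L`.  (`growth (E + 4)` at `L - 4`.) [folklore] -/
theorem growth256 (E : ℕ) : ∃ L₀ : ℕ, ∀ L, L₀ ≤ L →
    256 * ((L + E + 1) ^ (E + 5) * ((L + E + 1) ^ (E + 5) * (L + E + 1) ^ (E + 5))) ≤ 2 ^ L := by
  obtain ⟨L₀, hL₀⟩ := growth (E + 4)
  refine ⟨L₀ + 4, fun L hL => ?_⟩
  have h := hL₀ (L - 4) (by omega)
  have hbase : L - 4 + (E + 4) + 1 = L + E + 1 := by omega
  rw [hbase, show E + 4 + 1 = E + 5 by ring] at h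
  have h2 : 2 ^ (L - 4) * 16 = 2 ^ L := by
    rw [show (16 : ℕ) = 2 ^ 4 by norm_num, ← pow_add, Nat.sub_add_cancel (by omega : 4 ≤ L)]
  calc 256 * ((L + E + 1) ^ (E + 5) * ((L + E + 1) ^ (E + 5) * (L + E + 1) ^ (E + 5)))
      = 16 * ((L + E + 1) ^ (E + 5) * ((L + E + 1) ^ (E + 5) * (L + E + 1) ^ (E + 5))) * 16 := by ring
    _ ≤ 2 ^ (L - 4) * 16 := Nat.mul_le_mul_right 16 h
    _ = 2 ^ L := h2

/-- **`stub_cellContentRigid` (K2 of line `pair-descent-jss-endpoint` for cofactors of small rank across an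
arbitrary balanced cell partition; column mode).**  For all `c d` there is `n₀` such that for `n ≥ n₀`
every nonzero torus-homogeneous `h ∈ ℝ≥0[x_ij]` whose monomials have at most `2^{(log₂ n + c)^c}` distinct
`Y`-column-content vectors `(Σ_{r : (r,c) ∈ Y} m(r,c))_c`, for a cell set `Y` with at least `n/8` live
columns (more than `n/64` cells in `Y` and more than `n/64` outside), admits a placement `eR eC` of
`G(b,k) ⊕ M₀` with `(log₂ n + d)^d ≤ b`, a weight `w` cutting out the placed face, and a single `G`-part
`u` of the top-`w` fibre of `h`.  Core columns by counting inside the live columns, rows greedy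
(`stub_greedyRows`), generic weight, splits detect circulations (`stub_splitFlow`). [folklore] -/
theorem stub_cellContentRigid :
    ∀ c d : ℕ, ∃ n₀ : ℕ, ∀ n ≥ n₀, ∀ h : MvPolynomial (Fin n × Fin n) ℝ≥0,
      h ≠ 0 → IsTorusHomogeneous h → ∀ Y : Finset (Fin n × Fin n),
      n ≤ 8 * (Finset.univ.filter fun c : Fin n =>
          n / 64 < (Finset.univ.filter fun r : Fin n => (r, c) ∈ Y).card ∧
          n / 64 < (Finset.univ.filter fun r : Fin n => (r, c) ∉ Y).card).card →
      (h.support.image fun (mm : (Fin n × Fin n) →₀ ℕ) (cc : Fin n) =>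
          ∑ r ∈ Finset.univ.filter (fun r : Fin n => (r, cc) ∈ Y), mm (r, cc)).card ≤ 2 ^ ((Nat.log 2 n + c) ^ c) →
      ∃ (b k m : ℕ) (eR eC : BlockV b k m ≃ Fin n) (w : Fin n × Fin n → ℕ)
        (u : (Fin n × Fin n) →₀ ℕ),
        (Nat.log 2 n + d) ^ d ≤ b ∧ CutsOut w (placedBlock eR eC) ∧
          HasSingleGPart (placedBlock eR eC) w h u := by
  intro c d
  obtain ⟨L₀, hL₀⟩ := growth256 (c + d)
  refine ⟨2 ^ (L₀ + 1), fun n hn h hh htor Y hlive hcard => ?_⟩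
  classical
  -- the parameters
  have hn0 : n ≠ 0 := by
    have : 1 ≤ 2 ^ (L₀ + 1) := Nat.one_le_two_pow
    omega
  have hLL₀ : L₀ + 1 ≤ Nat.log 2 n := Nat.le_log_of_pow_le one_lt_two hn
  have h2L : 2 ^ Nat.log 2 n ≤ n := Nat.pow_log_le_self 2 hn0
  have hq256 := hL₀ (Nat.log 2 n) (by omega)
  set L := Nat.log 2 n with hL
  have hy : 2 ≤ L + (c + d) + 1 := by omega
  have hdq : (L + d) ^ d ≤ (L + (c + d) + 1) ^ (c + d + 5) :=
    (Nat.pow_le_pow_left (by omega) d).trans (Nat.pow_le_pow_right (by omega) (by omega))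
  have hq2 : 2 ≤ (L + (c + d) + 1) ^ (c + d + 5) :=
    (Nat.le_self_pow (by omega) 2).trans (Nat.pow_le_pow_left hy _)
  have h2c : 2 * (L + c) ^ c ≤ (L + (c + d) + 1) ^ (c + d + 5) :=
    calc 2 * (L + c) ^ c ≤ (L + (c + d) + 1) * (L + (c + d) + 1) ^ c :=
          Nat.mul_le_mul hy (Nat.pow_le_pow_left (by omega) c)
      _ = (L + (c + d) + 1) ^ (c + 1) := by ring
      _ ≤ (L + (c + d) + 1) ^ (c + d + 5) := Nat.pow_le_pow_right (by omega) (by omega)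
  set q := (L + (c + d) + 1) ^ (c + d + 5) with hq
  obtain ⟨h4N, h2N⟩ := four_mul_coreCount_le q hq2
  set N := q + q * (q * (q + 1)) with hN
  have h64N : 64 * N ≤ n := le_trans (by omega) (hq256.trans h2L)
  have hNdiv : N ≤ n / 64 := (Nat.le_div_iff_mul_le (by norm_num)).mpr (by omega)
  have hk : 0 < q + 1 := Nat.succ_pos q
  -- the live columns
  set LC := (Finset.univ.filter fun cc : Fin n =>
      n / 64 < (Finset.univ.filter fun r : Fin n => (r, cc) ∈ Y).card ∧
      n / 64 < (Finset.univ.filter fun r : Fin n => (r, cc) ∉ Y).card) with hLC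
  have hLCcard : 32 * (q * (q * q)) ≤ LC.card := by omega
  -- the column-content map and the bad pairs of its values (live part of the difference set)
  set colY : ((Fin n × Fin n) →₀ ℕ) → (Fin n → ℕ) := fun mm cc =>
    ∑ r ∈ Finset.univ.filter (fun r : Fin n => (r, cc) ∈ Y), mm (r, cc) with hcolY
  set V := h.support.image colY with hV
  let T : (Fin n → ℕ) × (Fin n → ℕ) → Finset (Fin n) := fun p =>
    Finset.univ.filter fun cc => p.1 cc ≠ p.2 cc
  let T' : (Fin n → ℕ) × (Fin n → ℕ) → Finset {cc // cc ∈ LC} := fun p =>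
    (T p).subtype fun cc => cc ∈ LC
  set P := (V ×ˢ V).filter fun p => q ≤ (T' p).card with hP
  have hPcard : P.card ≤ 2 ^ q :=
    calc P.card ≤ (V ×ˢ V).card := Finset.card_filter_le _ _
      _ = V.card * V.card := Finset.card_product _ _
      _ ≤ 2 ^ ((L + c) ^ c) * 2 ^ ((L + c) ^ c) := Nat.mul_le_mul hcard hcard
      _ = 2 ^ (2 * (L + c) ^ c) := by rw [two_mul, pow_add]
      _ ≤ 2 ^ q := Nat.pow_le_pow_right two_pos h2c
  -- a good set of `N` LIVE core columns
  obtain ⟨R', hR'card, hR'good⟩ := exists_goodSubset P T' N q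
    (fun p hp => (Finset.mem_filter.mp hp).2)
    (by rw [Fintype.card_coe]; exact count_lt (by omega) (by omega) hPcard (by omega))
  set S : Finset (Fin n) := R'.map (Function.Embedding.subtype _) with hS
  have hScard : S.card = N := by rw [hS, Finset.card_map, hR'card]
  have hSlive : ∀ cc ∈ S, cc ∈ LC := by
    intro cc hcc
    rw [hS, Finset.mem_map] at hcc
    obtain ⟨x, -, rfl⟩ := hcc
    exact x.2
  -- the greedy placement: columns inside `S`, rows splitting every internal column
  have hSgreedy : ∀ cc ∈ S, N < (Finset.univ.filter fun r : Fin n => (r, cc) ∈ Y).card ∧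
      N < (Finset.univ.filter fun r : Fin n => (r, cc) ∉ Y).card := by
    intro cc hcc
    have hl := (Finset.mem_filter.mp (hSlive cc hcc)).2
    exact ⟨lt_of_le_of_lt hNdiv hl.1, lt_of_le_of_lt hNdiv hl.2⟩
  obtain ⟨eR, eC, heC₁, heC₂, hsplit⟩ :=
    stub_greedyRows q (q + 1) (n - N) n Y S hScard (by omega) hSgreedy
  set G := placedBlock eR eC with hG
  set B := h.totalDegree + 1 with hB
  -- the generic weight cuts out `G`
  obtain ⟨g, hg⟩ := exists_blockMatching q (q + 1) (n - N) hk
  obtain ⟨σ₀, hσ₀⟩ := exists_perm_mem_placedBlock eR eC g hg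
  have hcut : CutsOut (genericWeight G B) G := cutsOut_genericWeight G (Nat.succ_pos _) σ₀ hσ₀
  -- the top fibre is a single monomial
  have hfib : ∀ m₁ ∈ (topComponent (genericWeight G B) h).support,
      ∀ m₂ ∈ (topComponent (genericWeight G B) h).support, m₁ = m₂ := by
    intro m₁ hm₁ m₂ hm₂
    have hs₁ := support_topComponent_subset _ h hm₁
    have hs₂ := support_topComponent_subset _ h hm₂
    obtain ⟨r₀, c₀, hrc⟩ := htor
    have hoff := eq_offG_of_mem_support_topComponent G hm₁ hm₂
      (degree_eq_of_rowDegrees_eq ((hrc m₁ hs₁).1.trans (hrc m₂ hs₂).1.symm))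
    by_contra hne
    -- the difference `D = m₁ - m₂`: supported on `G`, vanishing margins, nonzero
    obtain ⟨hrow, hcol⟩ := sum_diff_eq_zero ((hrc m₁ hs₁).1.trans (hrc m₂ hs₂).1.symm)
      ((hrc m₁ hs₁).2.trans (hrc m₂ hs₂).2.symm)
    set D : Fin n × Fin n → ℤ := fun e => (m₁ e : ℤ) - m₂ e with hD
    have hDG : ∀ e, D e ≠ 0 → e ∈ G := fun e he => by
      by_contra heG
      exact he (by simp only [hD, hoff e heG, sub_self])
    have hDne : ∃ e, D e ≠ 0 := by
      by_contra hall
      push Not at hall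
      exact hne (Finsupp.ext fun e => by exact_mod_cast sub_eq_zero.mp (hall e))
    obtain ⟨hcols, hnotpad⟩ :=
      stub_splitFlow q (q + 1) (n - N) n eR eC Y D hk hDG hrow hcol hsplit hDne
    -- the two column contents: their difference set is the set of columns with nonzero `Y`-sum …
    have hTeq : T (colY m₁, colY m₂) = Finset.univ.filter fun cc =>
        ∑ r ∈ Finset.univ.filter (fun r : Fin n => (r, cc) ∈ Y), D (r, cc) ≠ 0 := by
      refine Finset.filter_congr fun cc _ => ?_
      change (∑ r ∈ Finset.univ.filter (fun r : Fin n => (r, cc) ∈ Y), m₁ (r, cc) ≠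
        ∑ r ∈ Finset.univ.filter (fun r : Fin n => (r, cc) ∈ Y), m₂ (r, cc)) ↔ _
      rw [← colContent_sub_eq_sum _ m₁ m₂ cc, sub_ne_zero, Nat.cast_injective.ne_iff]
    -- … all of which are core columns, hence in `S` (live)
    have hTS : T (colY m₁, colY m₂) ⊆ S := by
      intro cc hcc
      rw [hTeq] at hcc
      have hcc' := (Finset.mem_filter.mp hcc).2
      obtain ⟨x, rfl⟩ := eC.surjective cc
      rcases x with i | p | u
      · exact heC₁ i
      · exact heC₂ p
      · exact absurd (eC.symm_apply_apply _) (hnotpad _ u hcc')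
    -- so the pair is bad, and its live part lies inside `R'`: excluded by the choice of `R'`
    have hT'card : q ≤ (T' (colY m₁, colY m₂)).card := by
      have hc : (T' (colY m₁, colY m₂)).card = (T (colY m₁, colY m₂)).card := by
        change ((T (colY m₁, colY m₂)).subtype fun cc => cc ∈ LC).card = _
        rw [Finset.card_subtype, Finset.filter_true_of_mem fun cc hcc => hSlive cc (hTS hcc)]
      rw [hc, hTeq]
      simpa only [Nat.add_sub_cancel] using hcols
    have hmem : (colY m₁, colY m₂) ∈ P :=
      Finset.mem_filter.mpr ⟨Finset.mk_mem_product (Finset.mem_image_of_mem _ hs₁)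
        (Finset.mem_image_of_mem _ hs₂), hT'card⟩
    refine hR'good _ hmem fun x hx => ?_
    have hxT : (x : Fin n) ∈ T (colY m₁, colY m₂) := by
      change x ∈ (T (colY m₁, colY m₂)).subtype (fun cc => cc ∈ LC) at hx
      exact (Finset.mem_subtype.mp hx)
    have hxS := hTS hxT
    rw [hS, Finset.mem_map] at hxS
    obtain ⟨y, hy, hyx⟩ := hxS
    have : y = x := Subtype.ext (by simpa using hyx)
    exact this ▸ hy
  -- conclusion: `u` is the `G`-part of the unique monomial of the top fibre
  obtain ⟨m₀, hm₀⟩ := support_nonempty.mpr (topComponent_ne_zero (genericWeight G B) hh)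
  refine ⟨q, q + 1, n - N, eR, eC, genericWeight G B, m₀.filter (· ∈ G), hdq, hcut,
    fun e he => ?_, fun m' hm' e he => ?_⟩
  · rw [Finsupp.support_filter] at he
    exact (Finset.mem_filter.mp he).2
  · rw [hfib m' hm' m₀ hm₀, Finsupp.filter_apply_pos _ _ he]

end Summit.ValiantsHypothesis.ValiantsHypothesis.Theorems.DivisionGapPerDivisionHard

end
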